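/-
Copyright (c) 2026 the pub-hodgecm-mathlib formalisation cell (harness21).  Prover seat hodgecm-mathlib-R90-C10-p04 (g2), SLAB R90-TF, section S1 «Ch. 10∕12 local»,
cell «U4-RAM :182 B_pos» (line (D-1) of R90-C10-p05 (g2), L4 dealer K2E3-plan (g5)): brick (B-4), PART 4 «THE SKEW-LINE FIBRES STRICTLY BETWEEN, BY ORTHOGONALITY» for the
U4Keys socket :182 (ramified `χ₁` of positive depth, Branch B) = S1 A2′, crux H413 = `stmt-HodgeConjecture-24833`.  KERNEL module: THEOREMS ONLY (no definition, no named
fact, no `sorry`, no instance, no notation).  2026-09-05.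
-/
import Summits.HodgeConjecture.HodgeConjecture.Theorems.R90S1BposSkewLineFibresDepth   -- ★ (B-4) PART 3 (this seat): (F∼) `skewLineIntegral_eq_of_valued_eq`, (F<₁), (F=), `isOpen_setOf_valued_eq_valued`; brings ★ PART 2, ★ PART 1 (§1 `integral_indicator_dite_eq_zero_of_mul_mem_iff`, §2 `integral_indicator_dite_map_ringDecomp_eq_of_prod`) and ★ (II)-b2∕b3a∕b1
import HarnessLib

/-!
# R90 · S1 ∕ U4Keys leaf (U4f-χ₁-ram-one-pos), BRANCH B — brick (B-4), PART 4: THE SKEW-LINE FIBRE `K(a)` STRICTLY BETWEEN THE CONDUCTOR AND `1` VANISHES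
# `K(a) := ∫_{y ∈ R⁻, |a + y|_w = 1} χ₁((a + y)^) dμ⁻(y) = 0` for a `σ`-fixed `a` with `0 < |a|_w < 1` as soon as `χ₁` has a depth witness STRICTLY below the level `|a|`
# [Keys1984 §4–§5, §7 Thm (2); WeilBNT1967 Ch. II §5; Roche1998 §3–§4; Rogawski1990 §1.10, §12.2 (2)]

Cell `pub/hodgecm-mathlib` (D-0151), SLAB R90-TF, section S1 «Ch. 10∕12 local», crux H413 = `stmt-HodgeConjecture-24833` (lane `--supports … --as helper`), route of record
`HCCMUnconditional` (no route verbs); prover seat `hodgecm-mathlib-R90-C10-p04` (g2), hand (B-4) of the B_pos line (D-1) led by R90-C10-p05 (g2) — item (F<₂) of the line lead's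
fibre list (R90 bus 2026-09-04T23:29:33Z).  THEOREMS ONLY (no `def`, no `instance`, no notation, no named-fact hypothesis, no `sorry`); ★-only imports (no `Lines` import).  NOT THE
PAYER of :182.

FRAME (= ★ (II)-b2∕(II)-b3a v1 spellings; PARTS 1–3 ★ `R90S1BposSkewBallCharacterTools` ∕ `…SkewLineCharacterIntegralDepth` ∕ `…SkewLineFibresDepth`): `R := LocalRing L v` at a
NON-SPLIT place `v` (`w hw`), `v ∤ 2` (`h2w`), `σ := conjLocal L c v`, `R⁺ = HeisRing.fixedPart σ`, `R⁻ = HeisRing.skewPart σ`, `E r := χ₁(r̂)` if `r` is a unit else `0` (inline `dite`),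
`μ⁻ = μY` a regular additive Haar measure on `R⁻`, `K(a) := ∫ y in {y | |(a + y)_w| = 1}, E(a + y) ∂μY` for a `σ`-FIXED `a : R`; the Branch-B-inert letter `hfix` «`χ₁ = 1` on the
`σ`-fixed units of absolute value one»; the LEVEL of `a` is `Valued.v (a w)`; the depth WITNESS is a unit `u₀` with `|(u₀ − 1)_w| < |a|_w` and `χ₁ u₀ ≠ 1`.

* §1 (F<₂) **`skewLineIntegral_eq_zero_of_witness_lt`** — STRICTLY BETWEEN: `0 < |a|_w < 1` and a unit `u₀` with `|(u₀ − 1)_w| < |a|_w`, `χ₁ u₀ ≠ 1` ⇒ `K(a) = 0`.  The Borel set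
  `W_a := {b : |(b + σb)_w| = |a|_w, |(b − σb)_w| = 1}` — in the decomposition `b = a′ + y` exactly `|a′|_w = |a|_w ∧ |y|_w = 1` (`b + σb = 2a′`, `b − σb = 2y`, `|2|_w = 1`) — is
  `u₀`-INVARIANT (`u₀b ± σ(u₀b) = (b ± σb) + (tb ± σ(tb))`, `t = u₀ − 1`, `|tb ± σ(tb)|_w ≤ |t|_w < |a|_w < 1`), so PART 1 §1 gives `∫_{W_a} E dμR = 0` for the Haar measure
  `μR = (μ⁺ ⊗ μ⁻)∘ringDecomp⁻¹`, PART 1 §2 turns it into `∫_{|a′| = |a|} K(a′) dμ⁺(a′) = μ⁺(S⁺_{|a|})·K(a)` (PART 3 (F∼): the fibre is constant on the sphere), and the sphere of `R⁺` of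
  radius `|a|_w ≠ 0` is open, non-empty (`∋ a`) and relatively compact ⟹ **`K(a) = 0`**.  (The levels strictly between the conductor and `1` of memo §3; (F<₃) «AT the sharp level
  `K(a) = −ε₀·μ⁻{|y|_w < 1}`» is PART 5 on the invariant set `{|(b + σb)_w| ≤ |a|_w, |(b − σb)_w| = 1}`.)
HONEST LABEL.  HC_CM is proved only modulo the 7 printed citations (2 remaining named inputs: hLiu418 = `stmt-HodgeConjecture-24832`, h413 = `stmt-HodgeConjecture-24833`) until rung 0
closes; count-neutral — this file does NOT pay :182 (nor :155); no printed citation is discharged; REL ≠ ★ ≠ BUILT.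

## References
* [Keys1984] D. Keys, *Principal series representations of special unitary groups over local fields*, Compositio Math. 51 (1984), §4–§5, §7 Theorem (2) p. 126.
* [WeilBNT1967] A. Weil, *Basic Number Theory* (1967), Ch. I §2–§4, Ch. II §5 (Haar measure under homotheties; orthogonality of a non-trivial character of a compact group).
* [Roche1998] A. Roche, *Types and Hecke algebras for principal series representations of split reductive p-adic groups*, Ann. Sci. ÉNS (4) 31 (1998), §3–§4.
* [Rogawski1990] J. D. Rogawski, *Automorphic Representations of Unitary Groups in Three Variables*, Ann. of Math. Stud. 123 (1990), §1.10 p. 9, §12.2 (2) p. 173.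
-/

set_option autoImplicit false
-- the mandated namespace has the single-problem summit's repeated segment (`HodgeConjecture.HodgeConjecture`)
set_option linter.dupNamespace false

noncomputable section

open NumberField IsDedekindDomain MeasureTheory Measure Topology Set
open scoped NNReal ENNReal
open Literature.NumberTheory Literature.NumberTheory.Automorphic Literature.NumberTheory.Automorphic.UnitaryGroup

namespace Summit.HodgeConjecture.HodgeConjecture.R90.S1.BposSkewLineFibresByOrthogonality

open Summit.HodgeConjecture.HodgeConjecture.Cruxes.H413
open Summit.HodgeConjecture.HodgeConjecture.Cruxes.H413.K2E3BranchBSkewUnitSign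
open Summit.HodgeConjecture.HodgeConjecture.Cruxes.H413.K2E3BranchBSkewLineIntegrals
open Summit.HodgeConjecture.HodgeConjecture.Cruxes.H413.K2E3BranchBSkewLineCharacterIntegral
open Summit.HodgeConjecture.HodgeConjecture.R90.S1.BposSkewBallCharacterTools
open Summit.HodgeConjecture.HodgeConjecture.R90.S1.BposSkewLineCharacterIntegralDepth
open Summit.HodgeConjecture.HodgeConjecture.R90.S1.BposSkewLineFibresDepth

variable (L : Type) [Field L] [NumberField L] [IsCMField L] (v : HeightOneSpectrum (𝓞 ↥(maximalRealSubfield L)))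
  (w : PlacesOver L v) (hw : IsCMField.complexConj L • w.1 = w.1)

section Fibres

variable [MeasurableSpace (LocalRing L v)] [BorelSpace (LocalRing L v)]
  (μY : Measure ↥(HeisRing.skewPart (conjLocal L (IsCMField.complexConj L) v))) [μY.IsAddHaarMeasure] [μY.Regular]

/-! ## §1 (F<₂) STRICTLY BETWEEN: `K(a) = 0` when a depth witness lies STRICTLY below the level `|a|` -/

open scoped Classical in
include hw in
/-- **(F<₂) — `0 < |a|_w < 1` and a unit `u₀` with `|(u₀ − 1)_w| < |a|_w`, `χ₁ u₀ ≠ 1` ⇒ `K(a) = 0`.**  The Borel set `W_a := {b : |(b + σb)_w| = |a|_w, |(b − σb)_w| = 1}` — in the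
decomposition `b = a′ + y` exactly `|a′|_w = |a|_w ∧ |y|_w = 1` (`b + σb = 2a′`, `b − σb = 2y`, `|2|_w = 1`) — is `u₀`-INVARIANT (`u₀b ± σ(u₀b) = (b ± σb) + (tb ± σ(tb))`, `t = u₀ − 1`,
`|tb ± σ(tb)|_w ≤ |t|_w < |a|_w ≤ 1`), so PART 1 §1 gives `∫_{W_a} E = 0`, PART 1 §2 turns it into `∫_{|a′| = |a|} K(a′) dμ⁺(a′) = μ⁺(S⁺_{|a|})·K(a)` ((F∼): the fibre is constant on the
sphere), and the sphere of `R⁺` of radius `|a|_w ≠ 0` is open, non-empty (`∋ a`) and relatively compact.  (The levels strictly between the conductor and `1`: memo §3 «`m ≥ 1`», lead's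
(F<₂).) [cite: Keys1984, §4–§5, §7 Theorem (2) p. 126] [cite: WeilBNT1967, Ch. II §5] [cite: Roche1998, §3–§4] -/
theorem skewLineIntegral_eq_zero_of_witness_lt (h2w : Valued.v (2 : w.1.adicCompletion L) = 1)
    (χ₁ : (LocalRing L v)ˣ →* ℂˣ) (h₁ : Continuous fun x => ((χ₁ x : ℂˣ) : ℂ))
    (hfix : ∀ u : (LocalRing L v)ˣ, (∀ w' : PlacesOver L v, Valued.v ((u : LocalRing L v) w') = 1) →
      conjLocal L (IsCMField.complexConj L) v (u : LocalRing L v) = u → χ₁ u = 1)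
    {a : LocalRing L v} (ha : conjLocal L (IsCMField.complexConj L) v a = a) (ha0 : Valued.v (a w) ≠ 0) (hav : Valued.v (a w) < 1)
    (u₀ : (LocalRing L v)ˣ) (hu₀ : Valued.v (((u₀ : LocalRing L v) - 1) w) < Valued.v (a w)) (hχ : χ₁ u₀ ≠ 1) :
    ∫ y in {y : ↥(HeisRing.skewPart (conjLocal L (IsCMField.complexConj L) v)) | Valued.v ((a + (y : LocalRing L v)) w) = 1},
        (fun r : LocalRing L v => if h : IsUnit r then ((χ₁ h.unit : ℂˣ) : ℂ) else 0) (a + (y : LocalRing L v)) ∂μY = 0 := by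
  letI : Invertible (2 : LocalRing L v) := (isUnit_two_localRing L v).invertible
  haveI : SecondCountableTopology (LocalRing L v) := secondCountableTopology_localRing (E := L) v
  have hσc := continuous_conjLocal L (IsCMField.complexConj L) v
  haveI := HeisRing.locallyCompactSpace_fixedPart (conjLocal L (IsCMField.complexConj L) v) hσc
  haveI := HeisRing.locallyCompactSpace_skewPart (conjLocal L (IsCMField.complexConj L) v) hσc
  haveI : SecondCountableTopology ↥(HeisRing.fixedPart (conjLocal L (IsCMField.complexConj L) v)) := TopologicalSpace.Subtype.secondCountableTopology _
  haveI : SecondCountableTopology ↥(HeisRing.skewPart (conjLocal L (IsCMField.complexConj L) v)) := TopologicalSpace.Subtype.secondCountableTopology _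
  -- names
  set E : LocalRing L v → ℂ := fun r : LocalRing L v => if h : IsUnit r then ((χ₁ h.unit : ℂˣ) : ℂ) else 0 with hEdef
  set c := Valued.v (a w) with hcdef
  set A : Set (LocalRing L v) := {b | Valued.v ((b + conjLocal L (IsCMField.complexConj L) v b) w) = c ∧
    Valued.v ((b - conjLocal L (IsCMField.complexConj L) v b) w) = 1} with hAdef
  set P : Set ↥(HeisRing.fixedPart (conjLocal L (IsCMField.complexConj L) v)) := {a' | Valued.v ((a' : LocalRing L v) w) = c} with hPdef
  set Y : Set ↥(HeisRing.skewPart (conjLocal L (IsCMField.complexConj L) v)) := {y | Valued.v ((y : LocalRing L v) w) = 1} with hYdef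
  set K : ℂ := ∫ y in {y : ↥(HeisRing.skewPart (conjLocal L (IsCMField.complexConj L) v)) | Valued.v ((a + (y : LocalRing L v)) w) = 1},
    E (a + (y : LocalRing L v)) ∂μY with hKdef
  -- valuation bookkeeping
  have hσv : ∀ b : LocalRing L v, Valued.v ((conjLocal L (IsCMField.complexConj L) v b) w) = Valued.v (b w) :=
    fun b => valued_conjLocal_apply_of_smul_eq L v w hw b
  have htwice : ∀ b : LocalRing L v, Valued.v ((b + b) w) = Valued.v (b w) := fun b => by
    rw [Pi.add_apply, ← two_mul, map_mul, h2w, one_mul]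
  have hA1 : ∀ b ∈ A, Valued.v (b w) = 1 := fun b hb => by
    refine le_antisymm ?_ ?_
    · have h : Valued.v ((b + b) w) ≤ 1 := by
        rw [show b + b = (b + conjLocal L (IsCMField.complexConj L) v b) + (b - conjLocal L (IsCMField.complexConj L) v b) by ring, Pi.add_apply]
        exact (Valuation.map_add _ _ _).trans (max_le (hb.1.le.trans hav.le) hb.2.le)
      rwa [htwice] at h
    · have h : Valued.v ((b - conjLocal L (IsCMField.complexConj L) v b) w) ≤ Valued.v (b w) := by
        rw [Pi.sub_apply]; exact (Valuation.map_sub _ _ _).trans (max_le le_rfl (hσv b).le)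
      exact hb.2 ▸ h
  have hunit1 : ∀ u : (LocalRing L v)ˣ, Valued.v (((u : LocalRing L v) - 1) w) < 1 → Valued.v ((u : LocalRing L v) w) = 1 := fun u hu => by
    have h : (u : LocalRing L v) w = 1 + ((u : LocalRing L v) - 1) w := by rw [Pi.sub_apply, Pi.one_apply, add_sub_cancel]
    rw [h]; exact Valuation.map_one_add_of_lt _ hu
  have hpert : ∀ (t b : LocalRing L v), Valued.v (t w) < c → Valued.v (b w) = 1 →
      Valued.v ((t * b + conjLocal L (IsCMField.complexConj L) v (t * b)) w) < c ∧ Valued.v ((t * b - conjLocal L (IsCMField.complexConj L) v (t * b)) w) < c := fun t b ht hb => by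
    have htb : Valued.v ((t * b) w) < c := by rw [Pi.mul_apply, map_mul, hb, mul_one]; exact ht
    have htb' : Valued.v ((conjLocal L (IsCMField.complexConj L) v (t * b)) w) < c := by rw [hσv]; exact htb
    exact ⟨by rw [Pi.add_apply]; exact lt_of_le_of_lt (Valuation.map_add _ _ _) (max_lt htb htb'),
      by rw [Pi.sub_apply]; exact lt_of_le_of_lt (Valuation.map_sub _ _ _) (max_lt htb htb')⟩
  have hstep : ∀ (u : (LocalRing L v)ˣ) (b : LocalRing L v), Valued.v (((u : LocalRing L v) - 1) w) < c → b ∈ A → (u : LocalRing L v) * b ∈ A := fun u b hu hb => by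
    obtain ⟨hp, hm⟩ := hpert ((u : LocalRing L v) - 1) b hu (hA1 b hb)
    have hsplitP : (u : LocalRing L v) * b + conjLocal L (IsCMField.complexConj L) v ((u : LocalRing L v) * b) =
        (b + conjLocal L (IsCMField.complexConj L) v b) +
          (((u : LocalRing L v) - 1) * b + conjLocal L (IsCMField.complexConj L) v (((u : LocalRing L v) - 1) * b)) := by
      rw [show (u : LocalRing L v) * b = b + ((u : LocalRing L v) - 1) * b by ring, map_add]; ring
    have hsplitM : (u : LocalRing L v) * b - conjLocal L (IsCMField.complexConj L) v ((u : LocalRing L v) * b) =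
        (b - conjLocal L (IsCMField.complexConj L) v b) +
          (((u : LocalRing L v) - 1) * b - conjLocal L (IsCMField.complexConj L) v (((u : LocalRing L v) - 1) * b)) := by
      rw [show (u : LocalRing L v) * b = b + ((u : LocalRing L v) - 1) * b by ring, map_add]; ring
    refine ⟨?_, ?_⟩
    · show Valued.v (((u : LocalRing L v) * b + conjLocal L (IsCMField.complexConj L) v ((u : LocalRing L v) * b)) w) = c
      rw [hsplitP, Pi.add_apply, Valuation.map_add_eq_of_lt_left _ (by rw [hb.1]; exact hp), hb.1]
    · show Valued.v (((u : LocalRing L v) * b - conjLocal L (IsCMField.complexConj L) v ((u : LocalRing L v) * b)) w) = 1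
      rw [hsplitM, Pi.add_apply, Valuation.map_add_eq_of_lt_left _ (by rw [hb.2]; exact lt_trans hm hav), hb.2]
  have hu₀inv : Valued.v ((((u₀⁻¹ : (LocalRing L v)ˣ) : LocalRing L v) - 1) w) < c := by
    have h : (((u₀⁻¹ : (LocalRing L v)ˣ) : LocalRing L v) - 1) w = -((((u₀⁻¹ : (LocalRing L v)ˣ) : LocalRing L v) w) * (((u₀ : LocalRing L v) - 1) w)) := by
      have h1 := units_apply_mul_inv_apply L v u₀ w
      simp only [Pi.sub_apply, Pi.one_apply]
      linear_combination h1
    rw [h, Valuation.map_neg, map_mul, valued_units_inv_apply_eq_one L v (hunit1 _ (lt_trans hu₀ hav)), one_mul]; exact hu₀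
  -- `A` is Borel and `u₀`-invariant
  have hA : MeasurableSet A := by
    have h : A = (fun b : LocalRing L v => (b + conjLocal L (IsCMField.complexConj L) v b) w) ⁻¹' {z : w.1.adicCompletion L | Valued.v z = Valued.v (a w)} ∩
        (fun b : LocalRing L v => (b - conjLocal L (IsCMField.complexConj L) v b) w) ⁻¹' {z : w.1.adicCompletion L | Valued.v z = 1} := rfl
    rw [h]
    exact (((isOpen_setOf_valued_eq_valued L v w ha0).preimage ((continuous_apply w).comp (continuous_id.add hσc))).measurableSet).inter
      (((isOpen_setOf_valued_eq_one L v w).preimage ((continuous_apply w).comp (continuous_id.sub hσc))).measurableSet)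
  have hAu : ∀ b : LocalRing L v, (u₀ : LocalRing L v) * b ∈ A ↔ b ∈ A := fun b => by
    refine ⟨fun h => ?_, fun h => hstep u₀ b hu₀ h⟩
    have h' := hstep u₀⁻¹ ((u₀ : LocalRing L v) * b) hu₀inv h
    rwa [← mul_assoc, Units.inv_mul, one_mul] at h'
  have hu₀' : ∀ w' : PlacesOver L v, Valued.v ((u₀ : LocalRing L v) w') = 1 := forall_placesOver_of_apply L v w hw (hunit1 _ (lt_trans hu₀ hav))
  -- the product structure
  have hP1 : P ⊆ {a' | Valued.v ((a' : LocalRing L v) w) ≤ 1} := fun a' ha' => by rw [Set.mem_setOf_eq, show Valued.v ((a' : LocalRing L v) w) = c from ha']; exact hav.le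
  have hY1 : Y ⊆ {y | Valued.v ((y : LocalRing L v) w) ≤ 1} := fun y hy => le_of_eq hy
  have hAPY : ∀ (a' : ↥(HeisRing.fixedPart (conjLocal L (IsCMField.complexConj L) v))) (y : ↥(HeisRing.skewPart (conjLocal L (IsCMField.complexConj L) v))),
      (a' : LocalRing L v) + (y : LocalRing L v) ∈ A ↔ a' ∈ P ∧ y ∈ Y := fun a' y => by
    have ha' : conjLocal L (IsCMField.complexConj L) v (a' : LocalRing L v) = a' := (HeisRing.mem_fixedPart_iff _ _).1 a'.2
    have hy : conjLocal L (IsCMField.complexConj L) v (y : LocalRing L v) = -(y : LocalRing L v) := (HeisRing.mem_skewPart_iff _ _).1 y.2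
    have hP2 : (a' : LocalRing L v) + (y : LocalRing L v) + conjLocal L (IsCMField.complexConj L) v ((a' : LocalRing L v) + (y : LocalRing L v)) =
        (a' : LocalRing L v) + (a' : LocalRing L v) := by rw [map_add, ha', hy]; ring
    have hM2 : (a' : LocalRing L v) + (y : LocalRing L v) - conjLocal L (IsCMField.complexConj L) v ((a' : LocalRing L v) + (y : LocalRing L v)) =
        (y : LocalRing L v) + (y : LocalRing L v) := by rw [map_add, ha', hy]; ring
    show (Valued.v (((a' : LocalRing L v) + (y : LocalRing L v) + conjLocal L (IsCMField.complexConj L) v ((a' : LocalRing L v) + (y : LocalRing L v))) w) = c ∧ _) ↔ _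
    rw [hP2, hM2, htwice, htwice]
    rfl
  -- `μ⁺` and the Haar measure on `R`
  obtain ⟨δ, hδ⟩ := exists_conjLocal_skew_unit L v
  set eP := HeisRing.mulSkewUnit (conjLocal L (IsCMField.complexConj L) v) δ hδ with hePdef
  set μP : Measure ↥(HeisRing.fixedPart (conjLocal L (IsCMField.complexConj L) v)) := μY.map eP.symm with hμPdef
  haveI hμP : μP.IsAddHaarMeasure := ContinuousAddEquiv.isAddHaarMeasure_map μY eP.symm
  haveI : (μP.prod μY).IsAddHaarMeasure := inferInstance
  haveI : ((μP.prod μY).map (HeisRing.ringDecomp (conjLocal L (IsCMField.complexConj L) v) (conjLocal_conjLocal_cm L v) hσc).symm).IsAddHaarMeasure :=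
    ContinuousAddEquiv.isAddHaarMeasure_map (μP.prod μY) (HeisRing.ringDecomp (conjLocal L (IsCMField.complexConj L) v) (conjLocal_conjLocal_cm L v) hσc).symm
  -- PART 1 §1 + §2, then (F∼) on the sphere
  have horth := integral_indicator_dite_eq_zero_of_mul_mem_iff L v w hw
    ((μP.prod μY).map (HeisRing.ringDecomp (conjLocal L (IsCMField.complexConj L) v) (conjLocal_conjLocal_cm L v) hσc).symm) χ₁ h₁ u₀ hu₀' hχ hA hAu
  rw [integral_indicator_dite_map_ringDecomp_eq_of_prod L v w hw χ₁ h₁ μP μY hA hA1 hP1 hY1 hAPY] at horth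
  have hfib : ∀ a' : ↥(HeisRing.fixedPart (conjLocal L (IsCMField.complexConj L) v)),
      P.indicator (fun a'' => ∫ y in Y, E ((a'' : LocalRing L v) + (y : LocalRing L v)) ∂μY) a' = P.indicator (fun _ => K) a' := fun a' => by
    by_cases ha'P : a' ∈ P
    · rw [Set.indicator_of_mem ha'P, Set.indicator_of_mem ha'P]
      have ha'c : Valued.v ((a' : LocalRing L v) w) = c := ha'P
      have ha'fix : conjLocal L (IsCMField.complexConj L) v (a' : LocalRing L v) = a' := (HeisRing.mem_fixedPart_iff _ _).1 a'.2
      -- the region over `a′` is the unit sphere `Y`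
      have hreg : {y : ↥(HeisRing.skewPart (conjLocal L (IsCMField.complexConj L) v)) | Valued.v (((a' : LocalRing L v) + (y : LocalRing L v)) w) = 1} = Y := by
        ext y
        rw [Set.mem_setOf_eq, valued_add_apply_eq_max L v w hw h2w ha'fix ((HeisRing.mem_skewPart_iff _ _).1 y.2), ha'c]
        show max c (Valued.v ((y : LocalRing L v) w)) = 1 ↔ Valued.v ((y : LocalRing L v) w) = 1
        constructor
        · intro h
          rcases le_total c (Valued.v ((y : LocalRing L v) w)) with hle | hle
          · rwa [max_eq_right hle] at h
          · rw [max_eq_left hle] at h; exact absurd h hav.ne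
        · intro h; rw [h]; exact max_eq_right hav.le
      rw [← hreg]
      exact skewLineIntegral_eq_of_valued_eq L v w hw μY χ₁ hfix ha ha'fix ha0 ha'c
    · rw [Set.indicator_of_notMem ha'P, Set.indicator_of_notMem ha'P]
  have hPm : MeasurableSet P := by
    have hR : MeasurableSet {x : LocalRing L v | Valued.v (x w) = Valued.v (a w)} := by
      have h : {x : LocalRing L v | Valued.v (x w) = Valued.v (a w)} =
          (fun x : LocalRing L v => x w) ⁻¹' {z : w.1.adicCompletion L | Valued.v z = Valued.v (a w)} := rfl
      rw [h]; exact ((isOpen_setOf_valued_eq_valued L v w ha0).preimage (continuous_apply w)).measurableSet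
    exact measurable_subtype_coe hR
  rw [integral_congr_ae (Filter.Eventually.of_forall hfib), integral_indicator_const K hPm, Complex.real_smul] at horth
  -- `0 < μ⁺(P) < ∞`
  have hPo : IsOpen P := by
    have h : P = (fun a' : ↥(HeisRing.fixedPart (conjLocal L (IsCMField.complexConj L) v)) => (a' : LocalRing L v) w) ⁻¹' {z : w.1.adicCompletion L | Valued.v z = Valued.v (a w)} := rfl
    rw [h]
    exact (isOpen_setOf_valued_eq_valued L v w ha0).preimage ((continuous_apply w).comp continuous_subtype_val)
  have hPne : P.Nonempty := ⟨⟨a, (HeisRing.mem_fixedPart_iff _ _).2 ha⟩, rfl⟩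
  have hPfin : μP P ≠ ⊤ := by
    have hBPc : IsCompact {a' : ↥(HeisRing.fixedPart (conjLocal L (IsCMField.complexConj L) v)) | Valued.v ((a' : LocalRing L v) w) ≤ 1} :=
      (HeisRing.isClosed_fixedPart _ hσc).isClosedEmbedding_subtypeVal.isCompact_preimage (isCompact_setOf_valued_apply_le_one L v w hw)
    exact ((measure_mono hP1).trans_lt hBPc.measure_lt_top).ne
  have hPpos : (μP.real P : ℂ) ≠ 0 := by
    rw [Ne, Complex.ofReal_eq_zero, measureReal_def, ENNReal.toReal_eq_zero_iff, not_or]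
    exact ⟨(hPo.measure_pos μP hPne).ne', hPfin⟩
  exact (mul_eq_zero.1 horth).resolve_left hPpos

end Fibres

end Summit.HodgeConjecture.HodgeConjecture.R90.S1.BposSkewLineFibresByOrthogonality

end
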